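/-
Origin: expansion seat `planner-pub-hodgecm-prl1-g3-0`, handover #9 2026-08-18T06:25:19Z (`HOME/pub-hodgecm-prl1-g3/lean/Prl1g3/IsotypicProjector.lean`, md5 ff3a330f, 133 lines);
landed by the gen-7 packager in gate run 25 as `HodgeCM/Automorphic/IsotypicProjector.lean` (verbatim).
-/
/-
Copyright: HodgeCMPerL adjudication package. WIP seat prl1-g3 (planner-pub-hodgecm-prl1-g3-0), file 9.
-/
import Mathlib.RingTheory.SimpleModule.Isotypic
import Mathlib.LinearAlgebra.Projection
import Mathlib.LinearAlgebra.Dimension.Finite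
import Mathlib.LinearAlgebra.FiniteDimensional.Defs

/-!
# Isotypic projectors of a semisimple module lie in the image of the acting algebra (Jacobson density)

The REDUCE seat's print-interface clause (I6) `IsoDatum.Expand` (`HodgeCM.StubTree.PairingReduction`, prl2-g4) —
"the isotypic projector is a finite combination of Hecke correspondences, each of which pairs by pull–pull" — is
derived in its docstring in two steps: (ALGEBRA) `H^{2,0}(P_Γ)` is a finite-dimensional SEMISIMPLE module over the
Hecke algebra `ℋ_{K_Γ}`, so the isotypic projector `e_π` lies in the image of `ℋ_{K_Γ}` — Bourbaki, *Algèbre* VIII §4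
no. 4 Cor. ("`(e_λ)` est une base de l'espace vectoriel `Z`", the centre of the bicommutant) with no. 5 Thm 3
(Jacobson density); (GEOMETRY) each double coset `𝟙_{K g K}` acts by a push–pull correspondence (Getz–Hahn (15.5)).

This file proves the ALGEBRA step in the kernel, for any ring `A`, any SEMISIMPLE `A`-module `M`, and — for the
final statement — any field `k` over which `A` is an algebra and `M` is finite-dimensional (scalar tower):

* `coIsotypic c := sSup (isotypicComponents A M \ {c})` is a complement of an isotypic component `c`
  (`isCompl_coIsotypic`; Mathlib's `sSupIndep_isotypicComponents`, `sSup_isotypicComponents`), and is fully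
  invariant (`isFullyInvariant_coIsotypic`);
* `isoProj hc : M →ₗ[A] M` — the ISOTYPIC PROJECTOR onto `c` along the other components; it commutes with every
  `A`-endomorphism (`isoProj_comm`: isotypic components are fully invariant), i.e. it is an endomorphism of `M` over
  its own endomorphism ring (`isoProjE`);
* **`exists_isoProj_eq_smul`** — `∃ r : A, ∀ m, isoProj hc m = r • m`: by Mathlib's `jacobson_density` there is
  `r ∈ A` agreeing with the projector on a `k`-basis, and both sides are `k`-linear.

Reading for (I6): `A = ℋ_{K_Γ}`, `M = H^{2,0}(P_Γ, ℂ)`, `k = ℂ`; so "`e_π = Σ_k a_k 𝟙_{K_Γ g_k K_Γ}` on `H^{2,0}(P_Γ)`" is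
citable BY NAME, and what stays print / seam of (I6) is the push–pull reading of the double-coset operators.
Kernel-checked, Mathlib only, no new axioms.
-/

namespace HodgeCM
namespace IsotypicAlgebra

variable {A : Type*} [Ring A] {M : Type*} [AddCommGroup M] [Module A M]

/-! ## 1. The complement of an isotypic component -/

/-- The sum of the OTHER isotypic components. -/
def coIsotypic (c : Submodule A M) : Submodule A M := sSup (isotypicComponents A M \ {c})

/-- (Ported verbatim from the HodgeCMPerL package; no docstring in the source.) -/
theorem isFullyInvariant_coIsotypic [IsSemisimpleModule A M] (c : Submodule A M) :
    (coIsotypic c).IsFullyInvariant :=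
  isFullyInvariant_iff_sSup_isotypicComponents.mpr ⟨_, Set.sdiff_subset, rfl⟩

/-- (Ported verbatim from the HodgeCMPerL package; no docstring in the source.) -/
theorem isCompl_coIsotypic [IsSemisimpleModule A M] {c : Submodule A M} (hc : c ∈ isotypicComponents A M) :
    IsCompl c (coIsotypic c) := by
  refine ⟨sSupIndep_isotypicComponents A M hc, codisjoint_iff.mpr ?_⟩
  rw [coIsotypic, ← sSup_insert, Set.insert_sdiff_singleton, Set.insert_eq_of_mem hc]
  exact sSup_isotypicComponents A M

/-! ## 2. The isotypic projector and its commutation with endomorphisms -/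

section Proj

variable [IsSemisimpleModule A M] {c : Submodule A M} (hc : c ∈ isotypicComponents A M)

/-- The **isotypic projector** onto the component `c` along the sum of the other components. -/
noncomputable def isoProj : M →ₗ[A] M := c.projection (coIsotypic c) (isCompl_coIsotypic hc)

/-- (Ported verbatim from the HodgeCMPerL package; no docstring in the source.) -/
theorem isoProj_apply_mem (m : M) : isoProj hc m ∈ c := Submodule.projection_apply_mem _ m

/-- (Ported verbatim from the HodgeCMPerL package; no docstring in the source.) -/
theorem isoProj_of_mem {m : M} (hm : m ∈ c) : isoProj hc m = m := Submodule.projection_apply_of_mem_left _ hm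

/-- (Ported verbatim from the HodgeCMPerL package; no docstring in the source.) -/
theorem isoProj_of_mem_coIsotypic {m : M} (hm : m ∈ coIsotypic c) : isoProj hc m = 0 :=
  Submodule.projection_apply_of_mem_right _ hm

/-- (Ported verbatim from the HodgeCMPerL package; no docstring in the source.) -/
theorem sub_isoProj_mem (m : M) : m - isoProj hc m ∈ coIsotypic c := by
  rw [isoProj, ← Submodule.projection_eq_self_sub_projection]
  exact Submodule.projection_apply_mem _ m

/-- (Ported verbatim from the HodgeCMPerL package; no docstring in the source.) -/
theorem isoProj_idem (m : M) : isoProj hc (isoProj hc m) = isoProj hc m := isoProj_of_mem hc (isoProj_apply_mem hc m)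

/-- **The isotypic projector commutes with every `A`-endomorphism** (isotypic components are fully invariant). -/
theorem isoProj_comm (φ : Module.End A M) (m : M) : isoProj hc (φ m) = φ (isoProj hc m) := by
  have hp : φ (isoProj hc m) ∈ c :=
    Submodule.IsFullyInvariant.of_mem_isotypicComponents hc φ (isoProj_apply_mem hc m)
  have hq : φ (m - isoProj hc m) ∈ coIsotypic c := isFullyInvariant_coIsotypic c φ (sub_isoProj_mem hc m)
  calc isoProj hc (φ m) = isoProj hc (φ (isoProj hc m) + φ (m - isoProj hc m)) := by
        rw [← map_add, add_sub_cancel]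
    _ = φ (isoProj hc m) := by rw [map_add, isoProj_of_mem hc hp, isoProj_of_mem_coIsotypic hc hq, add_zero]

/-- The isotypic projector as an endomorphism of `M` over its OWN endomorphism ring `End A M` (the input of the
Jacobson density theorem). -/
noncomputable def isoProjE : Module.End (Module.End A M) M where
  toFun := isoProj hc
  map_add' := map_add _
  map_smul' φ m := isoProj_comm hc φ m

/-- (Ported verbatim from the HodgeCMPerL package; no docstring in the source.) -/
@[simp] theorem isoProjE_apply (m : M) : isoProjE hc m = isoProj hc m := rfl

/-- Jacobson density, raw form: on any finite set the projector agrees with the action of some `r ∈ A`. -/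
theorem exists_isoProj_eq_smul_on (s : Finset M) : ∃ r : A, ∀ m ∈ s, isoProj hc m = r • m := by
  obtain ⟨r, hr⟩ := jacobson_density (isoProjE hc) s
  exact ⟨r, fun m hm => hr m hm⟩

end Proj

/-! ## 3. Over a field: the projector IS the action of an element of `A` -/

/-- **The isotypic projector lies in the image of the acting algebra.**  If `A` is a `k`-algebra and the semisimple
`A`-module `M` is finite-dimensional over the field `k` (compatibly), then for every isotypic component `c` there is
`r ∈ A` acting on ALL of `M` as the isotypic projector onto `c`. -/
theorem exists_isoProj_eq_smul {k : Type*} [Field k] [Algebra k A] [Module k M] [IsScalarTower k A M]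
    [FiniteDimensional k M] [IsSemisimpleModule A M] {c : Submodule A M} (hc : c ∈ isotypicComponents A M) :
    ∃ r : A, ∀ m : M, isoProj hc m = r • m := by
  classical
  let b := Module.finBasis k M
  obtain ⟨r, hr⟩ := exists_isoProj_eq_smul_on hc (Finset.univ.image b)
  refine ⟨r, fun m => ?_⟩
  -- both sides are `k`-linear and agree on the basis `b`
  let f : M →ₗ[k] M := (isoProj hc).restrictScalars k
  let g : M →ₗ[k] M :=
    { toFun := fun m => r • m
      map_add' := fun x y => smul_add r x y
      map_smul' := fun a x => (smul_comm a r x).symm }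
  have hfg : f = g := b.ext fun i => hr (b i) (Finset.mem_image_of_mem b (Finset.mem_univ i))
  exact congrArg (fun h : M →ₗ[k] M => h m) hfg

/-- Corollary in the shape (I6) uses: the projector of a vector is obtained by acting with ONE element of `A`,
uniformly in the vector; in particular for any `k`-bilinear pairing `B`, `B (e_c x) y = B (r • x) y`. -/
theorem pairing_isoProj_eq {k : Type*} [Field k] [Algebra k A] [Module k M] [IsScalarTower k A M]
    [FiniteDimensional k M] [IsSemisimpleModule A M] {c : Submodule A M} (hc : c ∈ isotypicComponents A M)
    {N : Type*} (B : M → M → N) : ∃ r : A, ∀ x y : M, B (isoProj hc x) y = B (r • x) y := by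
  obtain ⟨r, hr⟩ := exists_isoProj_eq_smul (k := k) hc
  exact ⟨r, fun x y => by rw [hr x]⟩

end IsotypicAlgebra
end HodgeCM
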